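import Summits.ValiantsHypothesis.ValiantsHypothesis.Theorems.LacunarySymmetroidMatrixDescartesCensusReflectBlocks

/-!
# `MatrixDescartes` census — reflective blocks, CANONICAL FORMS (re-ordering / negating the Sylvester forms of a block)

HONEST FRAMING.  Bookkeeping for the finite census of real symmetric lacunary pencils (cells `pub-symmetroid`, `val-V1-extremal`;
seat val-v1x-eng-8).  LOWER bounds only; nothing here bears on the asymptotic crux `Theses.LacunarySymmetroid.MatrixDescartes`
(stmt-ValiantsHypothesis-18050) nor on `VP ≠ VNP`.  No definitions.

`block_of_certCheckG` (`…CensusReflectBlocks`) delivers the Sylvester forms of a block in PIVOT order (the order in which the in-kernel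
`LDLᵀ` meets them).  For the junction law (`Chain.chain_append`, matching `p i · q (π i) > 0` along a permutation `π`) it is convenient
to publish every atom block with CANONICAL forms `(1,…,1,−1,…,−1)` so that all junctions match along `Equiv.refl`.  This file provides
the re-ordering (`form_perm`, `block_recanon`: any sign-matched target vectors along permutations of the two ends, by the tree's
Sylvester matching `Chain.exists_congr_of_diagonal`) and the negated block in one step (`block_neg_recanon`).  [folklore]
-/

-- `Summit.ValiantsHypothesis.ValiantsHypothesis.…` repeats a component by the D-0017 layout
-- (single-conjunct summit), which the `dupNamespace` linter flags; the name is mandated.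
set_option linter.dupNamespace false

namespace Summit.ValiantsHypothesis.ValiantsHypothesis.Theorems.LacunarySymmetroidMatrixDescartes.Census.Reflect

open Summit.ValiantsHypothesis.ValiantsHypothesis.Theorems.LacunarySymmetroidMatrixDescartes.Census
open scoped BigOperators Matrix

/-- **Re-ordering a Sylvester form**: from `Cᵀ A C = diagonal p` and a target `s` matched to `p` along a permutation
(`s i · p (π i) > 0`), also `C'ᵀ A C' = diagonal s`. [folklore] -/
theorem form_perm {m : ℕ} {A : Matrix (Fin m) (Fin m) ℝ} {p : Fin m → ℝ}
    (h : ∃ C : Matrix (Fin m) (Fin m) ℝ, C.det ≠ 0 ∧ Cᵀ * A * C = Matrix.diagonal p) (s : Fin m → ℝ)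
    (π : Equiv.Perm (Fin m)) (hs : ∀ i, 0 < s i * p (π i)) :
    ∃ C : Matrix (Fin m) (Fin m) ℝ, C.det ≠ 0 ∧ Cᵀ * A * C = Matrix.diagonal s :=
  Chain.exists_congr_of_diagonal (A := Matrix.diagonal s) (B := A)
    ⟨1, by simp, by rw [Matrix.transpose_one, Matrix.one_mul, Matrix.mul_one]⟩ h π hs

/-- **Re-canonising a block**: replace the bottom form `diagonal q` by `diagonal q'` and the top form `diagonal r` by `diagonal r'`
for any targets matched along permutations (`q' i · q (πb i) > 0`, `r' i · r (πt i) > 0`). [folklore] -/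
theorem block_recanon {m K N : ℕ} {q r : Fin m → ℝ}
    (h : ∃ (e : Fin (K + 1) → ℕ) (T : Fin (K + 1) → Matrix (Fin m) (Fin m) ℝ) (σ : Fin (N + 1) → ℝ),
      StrictMono e ∧
      (∀ h1 : 0 < K + 1, ∃ C : Matrix (Fin m) (Fin m) ℝ, C.det ≠ 0 ∧ Cᵀ * T ⟨0, h1⟩ * C = Matrix.diagonal q) ∧
      (∀ h1 : 0 < K + 1, ∃ C : Matrix (Fin m) (Fin m) ℝ, C.det ≠ 0 ∧
        Cᵀ * T ⟨K + 1 - 1, Nat.sub_lt h1 one_pos⟩ * C = Matrix.diagonal r) ∧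
      (∀ l, (T l).IsSymm) ∧ StrictMono σ ∧ (∀ j, 0 < σ j) ∧ (∀ j, (∑ l, σ j ^ e l • T l).det ≠ 0) ∧
      ∀ j : Fin N, (∑ l, σ j.castSucc ^ e l • T l).det * (∑ l, σ j.succ ^ e l • T l).det < 0)
    (q' r' : Fin m → ℝ) (πb πt : Equiv.Perm (Fin m)) (hq : ∀ i, 0 < q' i * q (πb i)) (hr : ∀ i, 0 < r' i * r (πt i)) :
    ∃ (e : Fin (K + 1) → ℕ) (T : Fin (K + 1) → Matrix (Fin m) (Fin m) ℝ) (σ : Fin (N + 1) → ℝ),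
      StrictMono e ∧
      (∀ h1 : 0 < K + 1, ∃ C : Matrix (Fin m) (Fin m) ℝ, C.det ≠ 0 ∧ Cᵀ * T ⟨0, h1⟩ * C = Matrix.diagonal q') ∧
      (∀ h1 : 0 < K + 1, ∃ C : Matrix (Fin m) (Fin m) ℝ, C.det ≠ 0 ∧
        Cᵀ * T ⟨K + 1 - 1, Nat.sub_lt h1 one_pos⟩ * C = Matrix.diagonal r') ∧
      (∀ l, (T l).IsSymm) ∧ StrictMono σ ∧ (∀ j, 0 < σ j) ∧ (∀ j, (∑ l, σ j ^ e l • T l).det ≠ 0) ∧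
      ∀ j : Fin N, (∑ l, σ j.castSucc ^ e l • T l).det * (∑ l, σ j.succ ^ e l • T l).det < 0 := by
  obtain ⟨e, T, σ, he, hb, ht, hT, hσ, hpos, hne, halt⟩ := h
  exact ⟨e, T, σ, he, fun h1 => form_perm (hb h1) q' πb hq, fun h1 => form_perm (ht h1) r' πt hr,
    hT, hσ, hpos, hne, halt⟩

/-- **Negated block, re-canonised**: the letters `−T l` (`Chain.block_smul … (−1)`) with bottom form `diagonal q'` and top form
`diagonal r'` for targets matched to `−q`, `−r` along permutations (`q' i · q (πb i) < 0`, `r' i · r (πt i) < 0`). [folklore] -/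
theorem block_neg_recanon {m K N : ℕ} {q r : Fin m → ℝ}
    (h : ∃ (e : Fin (K + 1) → ℕ) (T : Fin (K + 1) → Matrix (Fin m) (Fin m) ℝ) (σ : Fin (N + 1) → ℝ),
      StrictMono e ∧
      (∀ h1 : 0 < K + 1, ∃ C : Matrix (Fin m) (Fin m) ℝ, C.det ≠ 0 ∧ Cᵀ * T ⟨0, h1⟩ * C = Matrix.diagonal q) ∧
      (∀ h1 : 0 < K + 1, ∃ C : Matrix (Fin m) (Fin m) ℝ, C.det ≠ 0 ∧
        Cᵀ * T ⟨K + 1 - 1, Nat.sub_lt h1 one_pos⟩ * C = Matrix.diagonal r) ∧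
      (∀ l, (T l).IsSymm) ∧ StrictMono σ ∧ (∀ j, 0 < σ j) ∧ (∀ j, (∑ l, σ j ^ e l • T l).det ≠ 0) ∧
      ∀ j : Fin N, (∑ l, σ j.castSucc ^ e l • T l).det * (∑ l, σ j.succ ^ e l • T l).det < 0)
    (q' r' : Fin m → ℝ) (πb πt : Equiv.Perm (Fin m)) (hq : ∀ i, q' i * q (πb i) < 0) (hr : ∀ i, r' i * r (πt i) < 0) :
    ∃ (e : Fin (K + 1) → ℕ) (T : Fin (K + 1) → Matrix (Fin m) (Fin m) ℝ) (σ : Fin (N + 1) → ℝ),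
      StrictMono e ∧
      (∀ h1 : 0 < K + 1, ∃ C : Matrix (Fin m) (Fin m) ℝ, C.det ≠ 0 ∧ Cᵀ * T ⟨0, h1⟩ * C = Matrix.diagonal q') ∧
      (∀ h1 : 0 < K + 1, ∃ C : Matrix (Fin m) (Fin m) ℝ, C.det ≠ 0 ∧
        Cᵀ * T ⟨K + 1 - 1, Nat.sub_lt h1 one_pos⟩ * C = Matrix.diagonal r') ∧
      (∀ l, (T l).IsSymm) ∧ StrictMono σ ∧ (∀ j, 0 < σ j) ∧ (∀ j, (∑ l, σ j ^ e l • T l).det ≠ 0) ∧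
      ∀ j : Fin N, (∑ l, σ j.castSucc ^ e l • T l).det * (∑ l, σ j.succ ^ e l • T l).det < 0 := by
  refine block_recanon (Chain.block_smul h (-1) (by norm_num)) q' r' πb πt (fun i => ?_) (fun i => ?_)
  · have := hq i
    simp only [Pi.smul_apply, smul_eq_mul]
    nlinarith
  · have := hr i
    simp only [Pi.smul_apply, smul_eq_mul]
    nlinarith

/-! ### Smoke test: the toy block of `…CensusReflectBlocks` with its forms re-ordered along a swap, and negated. -/

example : ∃ (e : Fin (1 + 1) → ℕ) (T : Fin (1 + 1) → Matrix (Fin 2) (Fin 2) ℝ) (σ : Fin (2 + 1) → ℝ),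
    StrictMono e ∧
    (∀ h1 : 0 < 1 + 1, ∃ C : Matrix (Fin 2) (Fin 2) ℝ, C.det ≠ 0 ∧
      Cᵀ * T ⟨0, h1⟩ * C = Matrix.diagonal (![(1 : ℝ), (1 : ℝ)] : Fin 2 → ℝ)) ∧
    (∀ h1 : 0 < 1 + 1, ∃ C : Matrix (Fin 2) (Fin 2) ℝ, C.det ≠ 0 ∧
      Cᵀ * T ⟨1 + 1 - 1, Nat.sub_lt h1 one_pos⟩ * C = Matrix.diagonal (![(-1 : ℝ), (-1 : ℝ)] : Fin 2 → ℝ)) ∧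
    (∀ l, (T l).IsSymm) ∧ StrictMono σ ∧ (∀ j, 0 < σ j) ∧ (∀ j, (∑ l, σ j ^ e l • T l).det ≠ 0) ∧
    ∀ j : Fin 2, (∑ l, σ j.castSucc ^ e l • T l).det * (∑ l, σ j.succ ^ e l • T l).det < 0 :=
  block_neg_recanon toy_block _ _ (Equiv.mk ![1, 0] ![1, 0] (by decide) (by decide)) (Equiv.refl (Fin 2))
    (by intro i; fin_cases i <;> simp) (by intro i; fin_cases i <;> simp)

end Summit.ValiantsHypothesis.ValiantsHypothesis.Theorems.LacunarySymmetroidMatrixDescartes.Census.Reflect
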